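import Summits.HubbardSuperconductivity.HubbardSuperconductivity.Theorems.InfiniteVolumeFirstCoarseTightnessBlockModes
import Summits.HubbardSuperconductivity.HubbardSuperconductivity.Theorems.EnslavedA1gTorusNormalForms
import Literature.MathematicalPhysics.QuantumLattice.DirichletSineBasis
import Literature.MathematicalPhysics.QuantumLattice.BlockKernelBridge
import Literature.MathematicalPhysics.QuantumLattice.DirichletBlockLevels
import Literature.MathematicalPhysics.QuantumLattice.TorusBandRefinement
import Literature.MathematicalPhysics.QuantumLattice.BlockKineticSum
import Literature.MathematicalPhysics.QuantumLattice.HubbardPairDensityCouplingFloor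
import Literature.MathematicalPhysics.QuantumLattice.FreeFermionSectorGroundStates
import HarnessLib

/-!
# Coarse tightness programme — the LOCAL kinetic budget: the block occupation deviations of a
# weak-coupling Hubbard ground state are small on average over the translates

Crux `NoInfraredPileUp` (stmt-HubbardSuperconductivity-18534) / `NoNormalLimitState` (stmt-18533),
route `InfiniteVolumeFirst`; calibration programme "mesoscopic pair-order ceiling"
(PLAN-coarse-tightness.md, steps S0, S1, S5′, S7, S8). For a normalised ground state `ψ` of
`hubbardTorus 2 L 1 U` (`0 ≤ U`) in a sector `(2n, S^z = 0)`, a block side `R` with `2R + 2 ≤ L`,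
and the Dirichlet sine modes `φ_j = blockMode R j` of the translates `a + [0,R)²`, write
`x^{aσ}_j = Re ⟨ψ, n(f^{aσ}_j) ψ⟩ ∈ [0,1]` for the occupation of the block mode `j` with spin `σ` in the
block at `a`, and `ε_j = torusBand (2R+2) (blockMomentum R j)` for the block levels. We prove

  `∃ μ ∈ [-4,4],  Σ_a Σ_σ Σ_j |ε_j - μ| · x^{aσ}_j (1 - x^{aσ}_j) ≤ L² R² (U + C/R)`,
  `C = 72 + 32π`   (`deviationBudget`),

i.e. per translate and per unit block area the energy-weighted smearing of the block occupations is
`O(U + 1/R)`. Ingredients: the pointwise bathtub inequality at every chemical potential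
(`min_add_mul_add_le`: `min(ε-μ,0) + μx + |ε-μ|x(1-x) ≤ εx` on `[0,1]`); the one-body expansion of the
block hopping / number operators in the sine modes (`…CoarseTightnessBlockModes`,
`DirichletSineBasis`, `BlockKernelBridge`); the translate multiplicities `Σ_a h_a = R(R-1)H_hop`,
`Σ_a N_a = R² N` (`BlockKineticSum`) and `hubbardTorus_eq_sum_unitSteps`; the tree's first-order
kinetic budget `Re⟨ψ,H₀ψ⟩ ≤ minEnergyOn H₀ + U L²` and the free sector floor `2Σ_{k∈F} ε_L(k)`; and the
block-vs-torus comparison of grand-canonical band sums (`DirichletBlockLevels`, `TorusBandRefinement`),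
in which the chemical-potential terms cancel exactly.

No definition and no named fact is introduced.
-/

noncomputable section

-- the mandated namespace `Summit.<Summit>.<Problem>.Theorems` repeats `HubbardSuperconductivity`
-- (single-problem summit, D-0017), which the `dupNamespace` linter flags on every declaration
set_option linter.dupNamespace false

namespace Summit.HubbardSuperconductivity.HubbardSuperconductivity.Theorems.CoarseTightness

open Literature.MathematicalPhysics.QuantumLattice Literature.Probability.LatticeModels Matrix Finset
open Literature.MathematicalPhysics.QuantumLattice.RayleighBound
open scoped ComplexConjugate ComplexOrder

/-! ### Real-variable input: the bathtub inequality at every chemical potential -/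

/-- **Bathtub with deviations, pointwise**: for `0 ≤ x ≤ 1`,
`min(ε - μ, 0) + μ x + |ε - μ| x (1 - x) ≤ ε x`. [folklore] -/
theorem min_add_mul_add_le (ε μ x : ℝ) (hx0 : 0 ≤ x) (hx1 : x ≤ 1) :
    min (ε - μ) 0 + μ * x + |ε - μ| * (x * (1 - x)) ≤ ε * x := by
  rcases le_or_gt μ ε with h | h
  · rw [min_eq_right (sub_nonneg.2 h), abs_of_nonneg (sub_nonneg.2 h)]
    nlinarith [mul_nonneg (sub_nonneg.2 h) hx0, mul_nonneg hx0 (sub_nonneg.2 hx1)]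
  · rw [min_eq_left (sub_neg.2 h).le, abs_of_neg (sub_neg.2 h)]
    nlinarith [mul_nonneg (sub_nonneg.2 h.le) (sub_nonneg.2 hx1), mul_nonneg hx0 (sub_nonneg.2 hx1)]

/-! ### Block-mode occupations -/

section Occupations

variable {ι : Type*} [LinearOrder ι] [Fintype ι]

/-- `Re ⟨ψ, n(f) ψ⟩ = ‖c(f) ψ‖² ≥ 0`. [folklore] -/
theorem re_expect_numberMode_eq_normSq (f : ι → ℂ) (ψ : Fock ι) :
    (star ψ ⬝ᵥ (numberMode f *ᵥ ψ)).re = normSq (annihilate f *ᵥ ψ) := by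
  rw [numberMode, ← annihilate_conjTranspose, star_dotProduct_conjTranspose_mul_mulVec,
    star_dotProduct_self_eq_normSq, Complex.ofReal_re]

/-- For a unit mode `f` and any `ψ`: `‖c(f)ψ‖² + ‖c†(f)ψ‖² = ‖ψ‖²` (CAR). [folklore] -/
theorem normSq_annihilate_add_normSq_create_of_unit {f : ι → ℂ} (hf : star f ⬝ᵥ f = 1)
    (ψ : Fock ι) : normSq (annihilate f *ᵥ ψ) + normSq (create f *ᵥ ψ) = normSq ψ := by
  have hsum : star (annihilate f *ᵥ ψ) ⬝ᵥ (annihilate f *ᵥ ψ) +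
      star (create f *ᵥ ψ) ⬝ᵥ (create f *ᵥ ψ) = star ψ ⬝ᵥ ψ := by
    rw [← star_dotProduct_conjTranspose_mul_mulVec, annihilate_conjTranspose,
      ← star_dotProduct_conjTranspose_mul_mulVec, create_conjTranspose, ← dotProduct_add,
      ← add_mulVec, add_comm, annihilate_mul_create_add, hf, one_smul, one_mulVec]
  have h := congrArg Complex.re hsum
  simpa only [Complex.add_re, star_dotProduct_self_eq_normSq, Complex.ofReal_re] using h

/-- **Occupations lie in `[0,1]`**: for a unit mode `f` and a unit vector `ψ`,
`0 ≤ Re ⟨ψ, n(f) ψ⟩ ≤ 1`. [folklore] -/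
theorem re_expect_numberMode_mem_Icc {f : ι → ℂ} (hf : star f ⬝ᵥ f = 1) {ψ : Fock ι}
    (hψ : star ψ ⬝ᵥ ψ = 1) : (star ψ ⬝ᵥ (numberMode f *ᵥ ψ)).re ∈ Set.Icc (0 : ℝ) 1 := by
  rw [re_expect_numberMode_eq_normSq]
  have h1 : normSq ψ = 1 := by
    have h := congrArg Complex.re hψ
    rwa [star_dotProduct_self_eq_normSq, Complex.ofReal_re, Complex.one_re] at h
  have h := normSq_annihilate_add_normSq_create_of_unit hf ψ
  exact ⟨normSq_nonneg _, by linarith [normSq_nonneg (create f *ᵥ ψ)]⟩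

end Occupations

/-! ### The block expansions evaluated in a state -/

section Blocks

open Classical

variable {L : ℕ} [NeZero L]

/-- The block levels are the torus levels of side `2R+2` at the block momenta: the unit-weight block
eigenvalue is `-ε_j`. [folklore] -/
theorem blockEigen_one_eq_neg_blockLevel (R : ℕ) (j : Fin 2 → Fin R) :
    blockEigen R (fun _ => 1) j = -torusBand (2 * R + 2) (blockMomentum R j) :=
  blockEigen_one_one_eq_neg_torusBand R j

/-- **Energy expansion of one block, one spin, in a state**:
`-Σ_j ε_j x^{aσ}_j = Re ⟨ψ, (Σ_{u,v} A(u,v) c†_{a+u,σ}c_{a+v,σ}) ψ⟩`, `A` the block adjacency in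
unit-step form. [folklore] -/
theorem sum_blockLevel_mul_occupation_eq (a : TorusSite 2 L) {R : ℕ} (hRL : R ≤ L) (σ : Fin 2)
    (ψ : Fock (Orb (FermionTorus 2 L))) :
    -∑ j : Fin 2 → Fin R, torusBand (2 * R + 2) (blockMomentum R j) *
        (star ψ ⬝ᵥ (numberMode (Function.extend
          (fun u : Fin 2 → Fin R => orb (FermionTorus.ofTorusSite (a + fun i => ((u i : ℕ) : ZMod L))) σ)
          (fun u => ((blockMode R j u : ℝ) : ℂ)) 0) *ᵥ ψ)).re =
      (star ψ ⬝ᵥ ((∑ u : Fin 2 → Fin R, ∑ v : Fin 2 → Fin R,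
        (((∑ e ∈ unitSteps, if (∀ i, ((v i : ℕ) : ℤ) = ((u i : ℕ) : ℤ) + e i) then (1 : ℝ) else 0
          : ℝ) : ℂ)) •
          (creation (orb (FermionTorus.ofTorusSite (a + fun i => ((u i : ℕ) : ZMod L))) σ) *
            annihilation (orb (FermionTorus.ofTorusSite (a + fun i => ((v i : ℕ) : ZMod L))) σ) :
              Matrix (Finset (Orb (FermionTorus 2 L))) (Finset (Orb (FermionTorus 2 L))) ℂ)) *ᵥ ψ)).re := by
  rw [sum_smul_creation_mul_annihilation_eq (blockOrb_injective a hRL σ) (blockMode R)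
    (fun u v => ∑ e ∈ unitSteps, if (∀ i, ((v i : ℕ) : ℤ) = ((u i : ℕ) : ℤ) + e i) then (1 : ℝ) else 0)
    (blockEigen R (fun _ => 1)) (adjacencyStepKernel_eq_sum_blockMode R)]
  rw [Matrix.sum_mulVec, dotProduct_sum, Complex.re_sum, ← Finset.sum_neg_distrib]
  refine Finset.sum_congr rfl fun j _ => ?_
  rw [Matrix.smul_mulVec, dotProduct_smul, smul_eq_mul, Complex.re_ofReal_mul,
    blockEigen_one_eq_neg_blockLevel, neg_mul]

/-- **Parseval of one block, one spin, in a state**: `Σ_j x^{aσ}_j = Σ_u Re ⟨ψ, n_{a+u,σ} ψ⟩`.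
[folklore] -/
theorem sum_occupation_eq (a : TorusSite 2 L) {R : ℕ} (hRL : R ≤ L) (σ : Fin 2)
    (ψ : Fock (Orb (FermionTorus 2 L))) :
    ∑ j : Fin 2 → Fin R, (star ψ ⬝ᵥ (numberMode (Function.extend
        (fun u : Fin 2 → Fin R => orb (FermionTorus.ofTorusSite (a + fun i => ((u i : ℕ) : ZMod L))) σ)
        (fun u => ((blockMode R j u : ℝ) : ℂ)) 0) *ᵥ ψ)).re =
      ∑ u : Fin 2 → Fin R, (star ψ ⬝ᵥ ((numberOp (FermionTorus.ofTorusSite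
        (a + fun i => ((u i : ℕ) : ZMod L))) σ : Matrix (Finset (Orb (FermionTorus 2 L))) _ ℂ) *ᵥ ψ)).re := by
  have hM : ∀ u v : Fin 2 → Fin R, (if u = v then (1 : ℝ) else 0) =
      ∑ j : Fin 2 → Fin R, 1 * (blockMode R j u * blockMode R j v) := fun u v => by
    simp only [one_mul, sum_blockMode_mul_blockMode_swap]
  have h := sum_smul_creation_mul_annihilation_eq (blockOrb_injective a hRL σ) (blockMode R)
    (fun u v => if u = v then (1 : ℝ) else 0) (fun _ => 1) hM
  simp only [Complex.ofReal_one, one_smul] at h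
  have hdiag : ∑ u : Fin 2 → Fin R, ∑ v : Fin 2 → Fin R,
      (((if u = v then (1 : ℝ) else 0 : ℝ) : ℂ)) •
        (creation (orb (FermionTorus.ofTorusSite (a + fun i => ((u i : ℕ) : ZMod L))) σ) *
          annihilation (orb (FermionTorus.ofTorusSite (a + fun i => ((v i : ℕ) : ZMod L))) σ) :
            Matrix (Finset (Orb (FermionTorus 2 L))) (Finset (Orb (FermionTorus 2 L))) ℂ) =
      ∑ u : Fin 2 → Fin R, (numberOp (FermionTorus.ofTorusSite (a + fun i => ((u i : ℕ) : ZMod L))) σ :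
        Matrix (Finset (Orb (FermionTorus 2 L))) _ ℂ) := by
    refine Finset.sum_congr rfl fun u _ => ?_
    rw [Finset.sum_eq_single u]
    · simp [numberOp]
    · intro v _ hv; rw [if_neg (Ne.symm hv)]; simp
    · exact fun h => absurd (Finset.mem_univ _) h
  rw [hdiag] at h
  rw [← Complex.re_sum, ← dotProduct_sum, ← Matrix.sum_mulVec, ← h, Matrix.sum_mulVec, dotProduct_sum,
    Complex.re_sum]

/-- **The bathtub inequality of one block (both spins)**: for a unit `ψ` and every `μ`,
`Σ_σ [Σ_j min(ε_j-μ,0) + μ Σ_u Re⟨n_{a+u,σ}⟩ + Σ_j |ε_j-μ| x^{aσ}_j(1-x^{aσ}_j)]`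
`≤ -Σ_σ Re ⟨ψ, (block hopping term)_σ ψ⟩`. [folklore] -/
theorem block_bathtub (a : TorusSite 2 L) {R : ℕ} (hRL : R ≤ L) (μ : ℝ)
    (ψ : Fock (Orb (FermionTorus 2 L))) (hψ : star ψ ⬝ᵥ ψ = 1) (σ : Fin 2) :
    (∑ j : Fin 2 → Fin R, min (torusBand (2 * R + 2) (blockMomentum R j) - μ) 0) +
      μ * ∑ u : Fin 2 → Fin R, (star ψ ⬝ᵥ ((numberOp (FermionTorus.ofTorusSite
        (a + fun i => ((u i : ℕ) : ZMod L))) σ : Matrix (Finset (Orb (FermionTorus 2 L))) _ ℂ) *ᵥ ψ)).re +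
      ∑ j : Fin 2 → Fin R, |torusBand (2 * R + 2) (blockMomentum R j) - μ| *
        ((star ψ ⬝ᵥ (numberMode (Function.extend
          (fun u : Fin 2 → Fin R => orb (FermionTorus.ofTorusSite (a + fun i => ((u i : ℕ) : ZMod L))) σ)
          (fun u => ((blockMode R j u : ℝ) : ℂ)) 0) *ᵥ ψ)).re *
         (1 - (star ψ ⬝ᵥ (numberMode (Function.extend
          (fun u : Fin 2 → Fin R => orb (FermionTorus.ofTorusSite (a + fun i => ((u i : ℕ) : ZMod L))) σ)
          (fun u => ((blockMode R j u : ℝ) : ℂ)) 0) *ᵥ ψ)).re)) ≤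
      -(star ψ ⬝ᵥ ((∑ u : Fin 2 → Fin R, ∑ v : Fin 2 → Fin R,
        (((∑ e ∈ unitSteps, if (∀ i, ((v i : ℕ) : ℤ) = ((u i : ℕ) : ℤ) + e i) then (1 : ℝ) else 0
          : ℝ) : ℂ)) •
          (creation (orb (FermionTorus.ofTorusSite (a + fun i => ((u i : ℕ) : ZMod L))) σ) *
            annihilation (orb (FermionTorus.ofTorusSite (a + fun i => ((v i : ℕ) : ZMod L))) σ) :
              Matrix (Finset (Orb (FermionTorus 2 L))) (Finset (Orb (FermionTorus 2 L))) ℂ)) *ᵥ ψ)).re := by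
  rw [← sum_blockLevel_mul_occupation_eq a hRL σ ψ, neg_neg, ← sum_occupation_eq a hRL σ ψ,
    Finset.mul_sum, ← Finset.sum_add_distrib, ← Finset.sum_add_distrib]
  refine Finset.sum_le_sum fun j _ => ?_
  have hunit := star_mode_dotProduct_self (blockOrb_injective a hRL σ) (blockMode R)
    (sum_blockMode_mul_blockMode R) j
  have hx := re_expect_numberMode_mem_Icc hunit hψ
  exact min_add_mul_add_le _ μ _ hx.1 hx.2

end Blocks

/-! ### Registered stub (supports stmt-HubbardSuperconductivity-18534) -/

/-- Registered stub `stub_coarseBathtubPointwise`: the bathtub inequality at every chemical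
potential, the real-variable input of the local kinetic budget. [folklore] -/
theorem stub_coarseBathtubPointwise :
    ∀ ε μ x : ℝ, 0 ≤ x → x ≤ 1 → min (ε - μ) 0 + μ * x + |ε - μ| * (x * (1 - x)) ≤ ε * x :=
  fun ε μ x hx0 hx1 => min_add_mul_add_le ε μ x hx0 hx1

end Summit.HubbardSuperconductivity.HubbardSuperconductivity.Theorems.CoarseTightness

end
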